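import Summits.AtomisticToContinuum.Crystallization.Theorems.FrustratedLawDichotomyBumpSchurFloor
import Summits.AtomisticToContinuum.Crystallization.Theorems.FrustratedLawDichotomyBumpRadialConvolution

/-!
# FrustratedLawDichotomy · `SF₅` / `SF₄₅` / `SF₄` from a ONE-VARIABLE radial dominator certificate

Assembly of `…BumpSchurFloor.schurFloor_of_dominator` (floors from a 3-D dominator `K`) with `…BumpRadialConvolution.radial_convolution`
(convolution of radial functions in `ℝ³`): for a RADIAL dominator `K(u) = κ(‖u‖)` the domination hypothesis and the `L¹` budget become
ONE-VARIABLE statements about `κ`: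

* domination (`r > 0`): `−(V·w)(r) ≤ a³·(512π/3465)·(2π/r)·∫_{s>0} s κ(s) ∫_{|r−s|}^{r+s} τ·omega₂(τ/a) dτ ds`;
* budget: `4π·(∫_{s>0} s² κ(s) ds)·a³·256π/3465 ≤ A`.

★★ `schurFloor_of_radialCert` and the literal instances ★ `sf₅_of_radialCert` (`a = 1`, `A = 13/4000`, `w = w₅`), ★ `sf₄₅_of_radialCert`
(`a = 4/5`, `A = 3/400`, `w = w₄₅`; the floor beneath the residual of record `T′♭₄₅`), `sf₄_of_radialCert` (`a = 4/5`, `A = 29/2500`, `w = w₄`).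
After this file the Schur floors of column 27623 hold as soon as census / lens-5 exhibit ONE continuous `κ ≥ 0` passing these two
one-variable inequalities (lens-5 NODE-g34.md §3/§3bis closed forms `κ(s) = (s⁻⁶/6)·smoothstep₁(…)` suitably continued below `s = 1`,
census TAG 181-S(i) / amendment A) — an honest CERT-class target with no hidden 3-D bookkeeping left.

Also: `continuous_omega₂`, `omega₂_nonneg` (from the profile identity), the radial `L¹` dictionary `integrable_radial` / `integral_radial`
(`∫_{ℝ³} κ(‖u‖) du = 4π ∫_{s>0} s² κ(s) ds`).  DEF-FREE; [folklore] chaining; 0 sorry.  Prover hand 1, gen 13 (decomp-a2c),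
`--supports stmt-AtomisticToContinuum-27623`.
-/

noncomputable section

namespace Summit.AtomisticToContinuum.Crystallization.Theorems.FrustratedLawDichotomyBumpAutocorrelation

open MeasureTheory Set Real
open scoped BigOperators
open Literature.MathematicalPhysics.StatisticalMechanics (lennardJones)
open Summit.AtomisticToContinuum.Crystallization.Theorems.FrustratedLawDichotomySchurCut
  (omega₂ omega₂_zero omega₂_of_two_le SchurFloor tailPot SF₅ SF₄₅ SF₄ w₅ w₄₅ w₄ ω₅ ω₄ cutWeight smoothstep₁ w₅_eq_zero)

/-! ## §1. `omega₂`: continuity and positivity -/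

/-- `omega₂` is continuous (its polynomial branch vanishes at `2`). [folklore] -/
theorem continuous_omega₂ : Continuous omega₂ := by
  have h : omega₂ = fun x : ℝ => if (2:ℝ) ≤ x then (0:ℝ) else
      (1 - 11 / 6 * x ^ 2 + 33 / 16 * x ^ 4 - 77 / 64 * x ^ 5 + 33 / 256 * x ^ 7 - 11 / 1024 * x ^ 9 + 5 / 12288 * x ^ 11) := by
    funext x
    by_cases hx : x < 2
    · simp [omega₂, hx, not_le.mpr hx]
    · simp [omega₂, hx, not_lt.mp hx]
  rw [h]
  refine Continuous.if_le continuous_const (by fun_prop) continuous_const continuous_id ?_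
  intro x hx
  rw [← hx]; norm_num

/-- `0 ≤ omega₂ t` for `t ≥ 0` (it is a normalised autocorrelation). [folklore] -/
theorem omega₂_nonneg {t : ℝ} (ht : 0 ≤ t) : 0 ≤ omega₂ t := by
  have h := bump_autocorr (t • e0)
  rw [norm_smul, norm_e0, mul_one, Real.norm_of_nonneg ht] at h
  have hpos : 0 ≤ ∫ x, bump x * bump (x - t • e0) := integral_nonneg fun x => mul_nonneg (bump_nonneg _) (bump_nonneg _)
  rw [h] at hpos
  exact (mul_nonneg_iff_of_pos_left (by positivity)).mp hpos

/-! ## §2. The radial `L¹` dictionary in `ℝ³` -/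

/-- A radial function `κ(‖u‖)` is integrable on `ℝ³` once `s² κ(s)` is integrable on `(0, ∞)`. [folklore] -/
theorem integrable_radial {κ : ℝ → ℝ} (hκi : IntegrableOn (fun s => s ^ 2 * κ s) (Ioi 0)) :
    Integrable (fun u : EuclideanSpace ℝ (Fin 3) => κ ‖u‖) := by
  rw [MeasureTheory.integrable_fun_norm_addHaar (μ := (volume : Measure (EuclideanSpace ℝ (Fin 3)))) (f := κ)]
  have hdim : Module.finrank ℝ (EuclideanSpace ℝ (Fin 3)) = 3 := by simp
  simpa [hdim, smul_eq_mul] using hκi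

/-- `∫_{ℝ³} κ(‖u‖) du = 4π ∫_{s>0} s² κ(s) ds`. [folklore] -/
theorem integral_radial (κ : ℝ → ℝ) : ∫ u : EuclideanSpace ℝ (Fin 3), κ ‖u‖ = 4 * π * ∫ s in Ioi 0, s ^ 2 * κ s := by
  rw [MeasureTheory.integral_fun_norm_addHaar (volume : Measure (EuclideanSpace ℝ (Fin 3))) κ]
  have hdim : Module.finrank ℝ (EuclideanSpace ℝ (Fin 3)) = 3 := by simp
  rw [hdim]
  have hball : (volume : Measure (EuclideanSpace ℝ (Fin 3))).real (Metric.ball (0:EuclideanSpace ℝ (Fin 3)) 1) = π * 4 / 3 := by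
    rw [measureReal_def, EuclideanSpace.volume_ball_fin_three]
    simp [ENNReal.toReal_ofReal (by positivity : (0:ℝ) ≤ π * 4 / 3)]
  rw [hball]
  simp only [nsmul_eq_mul, smul_eq_mul, Nat.cast_ofNat]
  ring

/-! ## §3. The Schur floor from a one-variable radial certificate -/

/-- ★★ **SCHUR FLOOR FROM A ONE-VARIABLE RADIAL DOMINATOR CERTIFICATE.**  Let `a > 0`, `w` a tail weight with `w 0 = 0`, `κ : ℝ → ℝ`
continuous and nonnegative with `s² κ(s)` integrable on `(0, ∞)`.  If for every `r > 0`
`−(V·w)(r) ≤ a³·(512π/3465)·(2π/r)·∫_{s>0} s κ(s)·(∫_{|r−s|}^{r+s} τ·omega₂(τ/a) dτ) ds` and `4π·(∫_{s>0} s² κ)·a³·256π/3465 ≤ A`, then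
`SchurFloor w (omega₂(·/a)) A`. [folklore chaining] -/
theorem schurFloor_of_radialCert {a : ℝ} (ha : 0 < a) (w : ℝ → ℝ) (hw0 : w 0 = 0) (κ : ℝ → ℝ) (hκc : Continuous κ)
    (hκ0 : ∀ s, 0 ≤ κ s) (hκi : IntegrableOn (fun s => s ^ 2 * κ s) (Ioi 0))
    (hcert : ∀ r, 0 < r → -(tailPot w r) ≤
      a ^ 3 * (512 * π / 3465) * (2 * π / r * ∫ s in Ioi 0, s * κ s * ∫ τ in |r - s|..(r + s), τ * omega₂ (τ / a)))
    {A : ℝ} (hA : 4 * π * (∫ s in Ioi 0, s ^ 2 * κ s) * (a ^ 3 * (256 * π / 3465)) ≤ A) :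
    SchurFloor w (fun r => omega₂ (r / a)) A := by
  refine schurFloor_of_dominator ha w (fun u => κ ‖u‖) (fun u => hκ0 _) (integrable_radial hκi) (fun u => by rw [norm_neg]) ?_ ?_
  · intro z
    have hin : ∀ u : EuclideanSpace ℝ (Fin 3), ∫ x, bumpR a x * bumpR a (x - (z - u)) = a ^ 3 * (512 * π / 3465) * omega₂ (‖u - z‖ / a) :=
      fun u => by rw [bumpR_autocorr ha, norm_sub_rev]
    simp_rw [hin]
    rw [show (∫ u : EuclideanSpace ℝ (Fin 3), κ ‖u‖ * (a ^ 3 * (512 * π / 3465) * omega₂ (‖u - z‖ / a))) =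
        a ^ 3 * (512 * π / 3465) * ∫ u : EuclideanSpace ℝ (Fin 3), κ ‖u‖ * omega₂ (‖u - z‖ / a) by
      rw [← integral_const_mul]; congr 1; funext u; ring]
    by_cases hz : z = 0
    · subst hz
      have h0 : tailPot w 0 = 0 := by simp [tailPot, hw0]
      rw [norm_zero, h0, neg_zero]
      refine mul_nonneg (by positivity) (integral_nonneg fun u => mul_nonneg (hκ0 _) (omega₂_nonneg ?_))
      simp only [sub_zero]
      positivity
    · have hf : Continuous fun τ : ℝ => omega₂ (τ / a) := continuous_omega₂.comp (continuous_id.div_const a)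
      have hT : ∀ x : ℝ, 2 * a ≤ x → omega₂ (x / a) = 0 := fun x hx => omega₂_of_two_le (by rwa [le_div_iff₀ ha])
      have key := radial_convolution κ (fun τ => omega₂ (τ / a)) hκc hf (by positivity : (0:ℝ) ≤ 2 * a) hT hz
      rw [key]
      exact hcert ‖z‖ (norm_pos_iff.mpr hz)
  · rw [integral_radial]; exact hA

/-! ## §4. The literal instances -/

/-- `w₄₅ 0 = 0`. [folklore] -/
theorem w₄₅_zero : w₄₅ 0 = 0 := by norm_num [w₄₅, cutWeight, smoothstep₁]

/-- `w₄ 0 = 0`. [folklore] -/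
theorem w₄_zero : w₄ 0 = 0 := by norm_num [w₄, cutWeight, smoothstep₁]

/-- ★ **`SF₅` from a one-variable radial certificate** (`a = 1`, `A = 13/4000`, `w = w₅`). [folklore chaining] -/
theorem sf₅_of_radialCert (κ : ℝ → ℝ) (hκc : Continuous κ) (hκ0 : ∀ s, 0 ≤ κ s) (hκi : IntegrableOn (fun s => s ^ 2 * κ s) (Ioi 0))
    (hcert : ∀ r, 0 < r → -(tailPot w₅ r) ≤
      512 * π / 3465 * (2 * π / r * ∫ s in Ioi 0, s * κ s * ∫ τ in |r - s|..(r + s), τ * omega₂ τ))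
    (hA : 4 * π * (∫ s in Ioi 0, s ^ 2 * κ s) * (256 * π / 3465) ≤ 13 / 4000) : SF₅ := by
  have hω : (fun r => omega₂ (r / 1)) = ω₅ := by funext r; simp [ω₅]
  have h := schurFloor_of_radialCert one_pos w₅ (w₅_eq_zero (by norm_num)) κ hκc hκ0 hκi (A := 13 / 4000)
    (fun r hr => by simpa using hcert r hr) (by simpa using hA)
  rw [hω] at h
  exact h

/-- ★ **`SF₄₅` from a one-variable radial certificate** (`a = 4/5`, `A = 3/400`, `w = w₄₅`; the floor beneath the residual of record
`T′♭₄₅`). [folklore chaining] -/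
theorem sf₄₅_of_radialCert (κ : ℝ → ℝ) (hκc : Continuous κ) (hκ0 : ∀ s, 0 ≤ κ s) (hκi : IntegrableOn (fun s => s ^ 2 * κ s) (Ioi 0))
    (hcert : ∀ r, 0 < r → -(tailPot w₄₅ r) ≤
      (4 / 5 : ℝ) ^ 3 * (512 * π / 3465) * (2 * π / r * ∫ s in Ioi 0, s * κ s * ∫ τ in |r - s|..(r + s), τ * omega₂ (τ / (4 / 5))))
    (hA : 4 * π * (∫ s in Ioi 0, s ^ 2 * κ s) * ((4 / 5 : ℝ) ^ 3 * (256 * π / 3465)) ≤ 3 / 400) : SF₄₅ := by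
  have hω : (fun r => omega₂ (r / (4 / 5))) = ω₄ := by funext r; simp only [ω₄]; congr 1; ring
  have h := schurFloor_of_radialCert (by norm_num : (0:ℝ) < 4 / 5) w₄₅ w₄₅_zero κ hκc hκ0 hκi hcert hA
  rw [hω] at h
  exact h

/-- **`SF₄` from a one-variable radial certificate** (`a = 4/5`, `A = 29/2500`, `w = w₄`). [folklore chaining] -/
theorem sf₄_of_radialCert (κ : ℝ → ℝ) (hκc : Continuous κ) (hκ0 : ∀ s, 0 ≤ κ s) (hκi : IntegrableOn (fun s => s ^ 2 * κ s) (Ioi 0))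
    (hcert : ∀ r, 0 < r → -(tailPot w₄ r) ≤
      (4 / 5 : ℝ) ^ 3 * (512 * π / 3465) * (2 * π / r * ∫ s in Ioi 0, s * κ s * ∫ τ in |r - s|..(r + s), τ * omega₂ (τ / (4 / 5))))
    (hA : 4 * π * (∫ s in Ioi 0, s ^ 2 * κ s) * ((4 / 5 : ℝ) ^ 3 * (256 * π / 3465)) ≤ 29 / 2500) : SF₄ := by
  have hω : (fun r => omega₂ (r / (4 / 5))) = ω₄ := by funext r; simp only [ω₄]; congr 1; ring
  have h := schurFloor_of_radialCert (by norm_num : (0:ℝ) < 4 / 5) w₄ w₄_zero κ hκc hκ0 hκi hcert hA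
  rw [hω] at h
  exact h

end Summit.AtomisticToContinuum.Crystallization.Theorems.FrustratedLawDichotomyBumpAutocorrelation

end
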